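import Summits.ABC.IUTFork.Conditional.WRowHexLamSevenThirtyFourAllLevels
import Summits.ABC.IUTFork.Conditional.AbcOfSGenuineKLicence
import Summits.ABC.IUTFork.Cor312ThetaSideClosedK
import Summits.ABC.IUTFork.Cor312SettingDHVolWitness
import Summits.ABC.IUTFork.Cor312ProvKIdeles
import HarnessLib

/-!
# Branch C — the NUMBER-LEVEL typed [IUTchIII] Cor. 3.12 in READING (U) (`T.Cor312Of`) TRUE, NO hypothesis, at every genuine Θ-volume datum
# on the R-W lane's INHABITED levels / bands (part HEX k = 34 — row «C:UP-COMPANIONS-HEX-25-32», k = 33…40 leg (KEY UPCOMPANIONS25 (2)): abc-iut-C-cert-1 g9 (row «W:HEX-AXIS-REST-4») inhabited half-axis of λ_34 = 1/2 + 2/7^34 from L⁺(34) = 13293172227557 (`WRowHexLamSevenThirtyFourAllLevels`); generated junction, abc-iut-C-cert-3 gen 6)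

C scoreboard (abc-iut-C-cert-3 gen 6, INTAKE / CERTS pen). PROOF-ONLY junction file (no `def`, no new `Prop`, no instance, no notation; nothing
re-typed); SAME recipe and words as `AbcOfSCor312OfAllLevels` (p489045) / `…HexBands` (p498110) / `…InhRest{A,B}`:
`<licence theorem> ∘ GenuineK.cor312Of_of_licence (p435505) ∘ negLogTheta_settingPrVolSharp_pilotDataOfK_le_datum (p447368)` at one-point context data
(abc-iut-c312-7's `unitSigDH/unitSplitDH/unitQDataDH/unitLatticeDH`, `M := ℚ`), realising ideles `Cor312Prov.exists_realising_{q,theta}Ideles_pilotDataOfK`.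
Inputs BY NAME: the W-lane licence theorems listed per declaration (abc-iut-w6-d055 / abc-iut-C-cert-1 / abc-iut-W-neg-1 lineages over W-row-1's slot
socket `WRow.licence_triple_unconditional_slot` and the ceiling socket `WRow.licence_triple_unconditional_ceil` p512367); binders copied VERBATIM.

READING (numbers, no side): at each listed level / on each band the window certificates' number-binder instance (K, LINE-FREE) is a THEOREM at
every genuine datum; NO height bound follows (known triples, log q ≪ the content locus); cone binder untouched (C-R52); records UNCHANGED;
inhabited-as-typed ≠ true-in-print; non-emptiness / admissibility / (P6) at these levels NOT claimed; typed ≠ proved; instantiated ≠ endorsed;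
not a claim that abc is proved or refuted; no side taken on [IUTchIII] Cor 3.12 / [IUTchIV] Thm 1.10 or on any author.
[cite: Mochizuki2012, IUTchIII Cor. 3.12 p. 173–174, Step (xi-f) p. 184; IUTchIV Thm. 1.10 p. 22–23, Cor. 2.2 (ii) proof (P5)(P7) p. 46; IUTchI Ex. 3.2 (iv) p. 71]
[cite: DupuyHilado2025, §3.3, §3.4] [claim: Mochizuki2012, status: disputed]
-/

noncomputable section

open Set Function NumberField IsDedekindDomain

namespace Summit.ABC.IUTFork.Conditional

open Thm311 Thm311.Real Cor312 Cor312Vol Cor312Prov Literature.IUT.LogThetaLattice Literature.IUT.LogVolume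
  Literature.IUT.HodgeTheaters Literature.IUT.LogVolume.ThetaData Literature.IUT.LogVolume.Cor22
open Literature.NumberTheory.NumberFields Literature.NumberTheory.GaloisRepresentations.Ultrametric
open Literature.NumberTheory.DiophantineGeometry Literature.NumberTheory.DiophantineGeometry.GenEll Summit.ABC.ABC.Theorems

/-- **`T.Cor312Of` for every genuine Θ-volume datum `T : ThetaVolumeDatumAt (ratPoint ((2 : ℚ)⁻¹ + 2 / 7 ^ k)) l` under exactly the
binders of `WRow.licence_lamSeven_thirtyFour_all` (`WRowHexLamSevenThirtyFourAllLevels`), NO further hypothesis** — that licence through `GenuineK.cor312Of_of_licence` (p435505) + the Θ-descent p447368.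
[cite: Mochizuki2012, IUTchIII Cor. 3.12 p. 173–174; IUTchIV Cor. 2.2 (ii) proof (P5) p. 46] [claim: Mochizuki2012, status: disputed] -/
theorem Hex.cor312Of_lamSeven_thirtyFour_all {k l : ℕ} (hk : k = 34) (hl : l.Prime) (hl0 : 13293172227557 ≤ l)
    (T : Cor22.ThetaVolumeDatumAt (ratPoint ((2 : ℚ)⁻¹ + 2 / 7 ^ k)) l) : T.Cor312Of := by
  letI := T.instFieldF; letI := T.instNumberFieldF; letI := T.instAlgebraF; letI := T.instFieldK
  letI := T.instNumberFieldK; letI := T.instAlgebraK; letI := T.instFieldFbar; letI := T.instAlgebraFbar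
  letI := T.instAlgebraKFbar; letI := T.instIsElliptic
  obtain ⟨tq, htq0, htq1, htq⟩ := exists_realising_qIdeles_pilotDataOfK T.D
  obtain ⟨t, ht0, ht1, ht⟩ := exists_realising_thetaIdeles_pilotDataOfK T.D
  exact GenuineK.cor312Of_of_licence T.D T.K ℚ (fun _ _ => ∅) (fun _ _ => ∅) (fun _ _ _ => ∅) (fun _ _ _ => 0) (fun _ _ => ∅)
    (fun _ _ _ _ => ∅) 0 unitLatticeDH (unitSigDH (pilotDataOfK T.D T.K)) (unitSplitDH (pilotDataOfK T.D T.K))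
    (unitQDataDH (pilotDataOfK T.D T.K)) t tq T.isVolumeInputOf htq0 htq1 ht0 ht1 htq
    (WRow.licence_lamSeven_thirtyFour_all hk hl hl0 T (logvAnalytic_analyticLogv (F := T.K)) ℚ (fun _ _ => ∅) (fun _ _ => ∅) (fun _ _ _ => ∅)
      (fun _ _ _ => 0) (fun _ _ => ∅) (fun _ _ _ _ => ∅) 0 unitLatticeDH (unitSigDH (pilotDataOfK T.D T.K)) (unitSplitDH (pilotDataOfK T.D T.K))
      (unitQDataDH (pilotDataOfK T.D T.K)) tq t htq0 htq1 ht0 ht htq)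
    (negLogTheta_settingPrVolSharp_pilotDataOfK_le_datum T ℚ (fun _ _ => ∅) (fun _ _ => ∅) (fun _ _ _ => ∅) (fun _ _ _ => 0) (fun _ _ => ∅)
      (fun _ _ _ _ => ∅) 0 unitLatticeDH (unitSigDH (pilotDataOfK T.D T.K)) (unitSplitDH (pilotDataOfK T.D T.K)) (unitQDataDH (pilotDataOfK T.D T.K))
      tq t htq0 htq1 ht0 ht)

end Summit.ABC.IUTFork.Conditional

end
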